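import Literature.NumberTheory.LFunctions.MauduitRivatTypeIIOpening
import Literature.NumberTheory.LFunctions.MauduitRivatTypeIDecomposition
import HarnessLib

/-!
# The discrete Fourier transform of the middle-digit function: the carry decomposition `G = G₁ + G₂` (Mauduit–Rivat 2015, §7, first half of Lemma 11; Müllner 2017, Lemma 5.6; proved)

Everything in this file is PROVED (plus plain definitions). It begins the formalisation, for
unitary-matrix weights `F = U ∘ f`, of §7 of C. Mauduit, J. Rivat, *Prime numbers along
Rudin–Shapiro sequences*, J. Eur. Math. Soc. 17 (2015) (Lemma 11, the mean-square estimate of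
the discrete Fourier transform `G_{μ₀,μ₂−μ₀}` of `u ↦ f_{μ₁,μ₂}(u q^{μ₀})`), as adapted by
C. Müllner, Duke Math. J. 166 (2017), Lemma 5.6 ("one has to be careful to keep the order of
terms"). With `g(u) = φ(u k^{μ₀})`, `φ = f_{μ₁}⁻¹ f_{μ₂}` (`midFun`), `Λ = μ₂ − μ₀`, a scale
`μ₁ − μ₀ ≤ λ ≤ Λ`, `λ' = Λ − λ`, `α = μ₀ + λ` and a truncation parameter `ρ₃`:

* `gmat` — the unitary matrices `U(g(u))`; `gmat_eq_of_lt` — for `u = a + v k^λ` (`a < k^λ`,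
  `v < k^{λ'}`): `U(g(u)) = F_{μ₁}(a k^{μ₀})ᴴ F(a k^{μ₀} + v k^α)` (MR p. 2624: "observing that
  `0 ≤ u+vq^λ < q^{μ₂−μ₀}` and `(u+vq^λ)q^{μ₀} ≡ uq^{μ₀} mod q^{μ₁}`");
* `Lmat`, `gmatMain` — the main part `F_{μ₁}(ak^{μ₀})ᴴ · [F(ak^{μ₀}+wk^α) F(wk^α)ᴴ] · F(vk^α)`
  with `w = v mod k^{ρ₃}` (MR's `G_{…,λ,1}`: the quotient `F(x)F(y)ᴴ` is replaced through the carry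
  property by its truncation, which only depends on `v mod k^{ρ₃}`);
* `gmat_eq_gmatMain_of_not_mem` — they agree unless `v` is a carry violation of scale
  `(λ', α, ρ₃)`; `norm_gmat_sub_gmatMain_le` — the difference is always `≤ 2√d`;
* `sum_norm_sq_dftR_gmatErr_le` — **the `G₂`-part** (MR p. 2627: "`∑_k |G_{…,λ,2}(k+t)|² … ≤ q^{−ρ₃}`"):
  by Parseval over ALL `k^Λ` shifts, `∑_{j<k^Λ} ‖dftR (gmat − gmatMain)(j+t)‖² ≤ 4d · k^λ #V / k^Λ`,
  `V` the carry violations, hence `≤ 4dC k^{−ηρ₃}` under the carry property (`ρ₃ < λ'`).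

The `G₁`-part (Cauchy–Schwarz, the Fourier property and geometric sums) and the assembly of
Lemma 11 / Lemma 10 follow in `MauduitRivatFourierL2.lean`.

## References
* C. Mauduit, J. Rivat, J. Eur. Math. Soc. 17 (2015), §7, Lemma 11 (pp. 2623–2627).
  [MauduitRivat2015]
* C. Müllner, Duke Math. J. 166 (2017) = arXiv:1602.03042, Lemma 5.6 (p. 28). [Mullner2017]
-/

noncomputable section

open Finset Complex Matrix
open scoped FourierTransform InnerProductSpace ComplexConjugate Matrix.Norms.Frobenius

namespace Literature.NumberTheory.LFunctions.MauduitRivat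

variable {d : Type*} [Fintype d] [DecidableEq d] {G : Type*} [Group G]

/-! ## The middle-digit matrices and their splitting -/

/-- The unitary matrices `U(g(u))`, `g(u) = f_{μ₁}(uk^{μ₀})⁻¹ f_{μ₂}(uk^{μ₀})` (`midFun`).
[cite: MauduitRivat2015, (62) and (91)] -/
def gmat (U : G →* unitaryGroup d ℂ) (f : ℕ → G) (k μ₀ μ₁ μ₂ : ℕ) (u : ℕ) : Matrix d d ℂ :=
  (U (midFun k μ₀ μ₁ μ₂ f u) : Matrix d d ℂ)

/-- `U(g(u)) = F_{μ₁}(uk^{μ₀})ᴴ F_{μ₂}(uk^{μ₀})`. [folklore] -/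
theorem gmat_apply (U : G →* unitaryGroup d ℂ) (f : ℕ → G) (k μ₀ μ₁ μ₂ u : ℕ) :
    gmat U f k μ₀ μ₁ μ₂ u =
      (umat U (trunc k μ₁ f) (u * k ^ μ₀))ᴴ * umat U (trunc k μ₂ f) (u * k ^ μ₀) := by
  rw [gmat, midFun_apply, midQuot_apply, ← conjTranspose_coe_map_mul]

/-- `‖U(g(u))‖ = √d`. [folklore] -/
theorem norm_gmat (U : G →* unitaryGroup d ℂ) (f : ℕ → G) (k μ₀ μ₁ μ₂ u : ℕ) :
    ‖gmat U f k μ₀ μ₁ μ₂ u‖ = Real.sqrt (Fintype.card d) := by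
  rw [gmat, norm_coe_unitary]

/-- **The splitting `u = a + v k^λ`** (`a < k^λ`, `v < k^{λ'}`, `μ₁ − μ₀ ≤ λ`, `λ + λ' = μ₂ − μ₀`):
`U(g(a + vk^λ)) = F_{μ₁}(a k^{μ₀})ᴴ F(a k^{μ₀} + v k^{μ₀+λ})`.
[cite: MauduitRivat2015, Lemma 11 (proof, first display p. 2624)] -/
theorem gmat_add_mul (U : G →* unitaryGroup d ℂ) (f : ℕ → G) {k : ℕ} (hk : 0 < k) {μ₀ μ₁ μ₂ lam lam' : ℕ}
    (h01 : μ₀ ≤ μ₁) (hlam : μ₁ - μ₀ ≤ lam) (hsum : μ₀ + lam + lam' = μ₂) {a v : ℕ} (ha : a < k ^ lam)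
    (hv : v < k ^ lam') :
    gmat U f k μ₀ μ₁ μ₂ (a + v * k ^ lam) =
      (umat U (trunc k μ₁ f) (a * k ^ μ₀))ᴴ * umat U f (a * k ^ μ₀ + v * k ^ (μ₀ + lam)) := by
  rw [gmat_apply]
  have e : (a + v * k ^ lam) * k ^ μ₀ = a * k ^ μ₀ + v * k ^ (μ₀ + lam) := by rw [pow_add]; ring
  -- `F_{μ₂}` is `F` on `[0, k^{μ₂})`
  have hlt : a * k ^ μ₀ + v * k ^ (μ₀ + lam) < k ^ μ₂ := by
    have h0 : a * k ^ μ₀ < k ^ (μ₀ + lam) := by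
      calc a * k ^ μ₀ < k ^ lam * k ^ μ₀ := Nat.mul_lt_mul_of_lt_of_le ha le_rfl (by positivity)
        _ = k ^ (μ₀ + lam) := by rw [pow_add, mul_comm]
    have h2 : (v + 1) * k ^ (μ₀ + lam) ≤ k ^ lam' * k ^ (μ₀ + lam) := Nat.mul_le_mul_right _ hv
    have h3 : k ^ lam' * k ^ (μ₀ + lam) = k ^ μ₂ := by
      rw [← pow_add, ← hsum]; congr 1; omega
    nlinarith
  -- `F_{μ₁}` only sees `a k^{μ₀}`
  have hμ₁ : trunc k μ₁ f (a * k ^ μ₀ + v * k ^ (μ₀ + lam)) = trunc k μ₁ f (a * k ^ μ₀) := by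
    have : v * k ^ (μ₀ + lam) = (v * k ^ (μ₀ + lam - μ₁)) * k ^ μ₁ := by
      rw [mul_assoc, ← pow_add]; congr 2; omega
    rw [this, trunc_add_mul_pow]
  rw [e, umat, umat, hμ₁, trunc_of_lt f hlt]

/-- The left factor of the main part: `L(a, w) = F_{μ₁}(ak^{μ₀})ᴴ · F(ak^{μ₀} + wk^α) F(wk^α)ᴴ`,
`α = μ₀ + λ`. [cite: MauduitRivat2015, Lemma 11 (proof: the function c_λ(w, t))] -/
def Lmat (U : G →* unitaryGroup d ℂ) (f : ℕ → G) (k μ₀ μ₁ α : ℕ) (a w : ℕ) : Matrix d d ℂ :=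
  (umat U (trunc k μ₁ f) (a * k ^ μ₀))ᴴ * (umat U f (a * k ^ μ₀ + w * k ^ α) * (umat U f (w * k ^ α))ᴴ)

/-- The MAIN PART `G_{…,λ,1}` at the level of the sequence: for `u = a + vk^λ`,
`L(a, v mod k^{ρ₃}) · F(vk^α)`. [cite: MauduitRivat2015, Lemma 11 (G_{μ₀,μ₂−μ₀,λ,1})] -/
def gmatMain (U : G →* unitaryGroup d ℂ) (f : ℕ → G) (k μ₀ μ₁ lam ρ₃ : ℕ) (u : ℕ) : Matrix d d ℂ :=
  Lmat U f k μ₀ μ₁ (μ₀ + lam) (u % k ^ lam) (u / k ^ lam % k ^ ρ₃) * umat U f (u / k ^ lam * k ^ (μ₀ + lam))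

/-- `‖gmatMain u‖ = √d` (a product of unitary matrices). [folklore] -/
theorem norm_gmatMain (U : G →* unitaryGroup d ℂ) (f : ℕ → G) (k μ₀ μ₁ lam ρ₃ u : ℕ) :
    ‖gmatMain U f k μ₀ μ₁ lam ρ₃ u‖ = Real.sqrt (Fintype.card d) := by
  rw [gmatMain, Lmat, norm_mul_unitary, umat_mul_conjTranspose]
  show ‖((U (trunc k μ₁ f (u % k ^ lam * k ^ μ₀)) : unitaryGroup d ℂ) : Matrix d d ℂ)ᴴ * _‖ = _
  rw [conjTranspose_coe_map_mul, norm_coe_unitary]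

/-- **The main part is exact off the carry violations.** For `u = a + vk^λ` (`a < k^λ`, `v < k^{λ'}`)
with `v ∉ carryViolations k f λ' (μ₀+λ) ρ₃`: `U(g(u)) = gmatMain u`.
[cite: MauduitRivat2015, Lemma 11 (proof, (96))] -/
theorem gmat_eq_gmatMain_of_not_mem (U : G →* unitaryGroup d ℂ) (f : ℕ → G) {k : ℕ} (hk : 0 < k)
    {μ₀ μ₁ μ₂ lam lam' ρ₃ : ℕ} (h01 : μ₀ ≤ μ₁) (hlam : μ₁ - μ₀ ≤ lam) (hsum : μ₀ + lam + lam' = μ₂)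
    {a v : ℕ} (ha : a < k ^ lam) (hv : v < k ^ lam')
    (hnv : v ∉ carryViolations k f lam' (μ₀ + lam) ρ₃) :
    gmat U f k μ₀ μ₁ μ₂ (a + v * k ^ lam) = gmatMain U f k μ₀ μ₁ lam ρ₃ (a + v * k ^ lam) := by
  have hklam : 0 < k ^ lam := by positivity
  have hmod : (a + v * k ^ lam) % k ^ lam = a := by rw [Nat.add_mul_mod_self_right, Nat.mod_eq_of_lt ha]
  have hdiv : (a + v * k ^ lam) / k ^ lam = v := by
    rw [Nat.add_mul_div_right _ _ hklam, Nat.div_eq_of_lt ha, zero_add]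
  rw [gmat_add_mul U f hk h01 hlam hsum ha hv, gmatMain, hmod, hdiv, Lmat, Matrix.mul_assoc]
  congr 1
  -- the carry replacement: `F(x) = [F(x)F(y)ᴴ]F(y)` with the quotient truncated; `α = μ₀ + λ`
  have hKα : k ^ (μ₀ + lam) = k ^ lam * k ^ μ₀ := by rw [pow_add, mul_comm]
  have hKP : k ^ (μ₀ + lam + ρ₃) = k ^ ρ₃ * k ^ (μ₀ + lam) := by rw [pow_add, mul_comm]
  have haα : a * k ^ μ₀ < k ^ (μ₀ + lam) := by
    rw [hKα]; exact Nat.mul_lt_mul_of_lt_of_le ha le_rfl (by positivity)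
  -- non-violation with `n₁ = 0`, `n₂ = a k^{μ₀}`
  have hq : f (v * k ^ (μ₀ + lam) + 0 + a * k ^ μ₀) * (f (v * k ^ (μ₀ + lam) + 0))⁻¹ =
      f ((v * k ^ (μ₀ + lam) + 0 + a * k ^ μ₀) % k ^ (μ₀ + lam + ρ₃)) *
        (f ((v * k ^ (μ₀ + lam) + 0) % k ^ (μ₀ + lam + ρ₃)))⁻¹ := by
    by_contra hne
    exact hnv (mem_carryViolations.2 ⟨hv, 0, by positivity, a * k ^ μ₀, haα, hne⟩)
  simp only [add_zero] at hq
  -- the reductions mod `k^{α+ρ₃}`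
  have hred2 : (v * k ^ (μ₀ + lam)) % k ^ (μ₀ + lam + ρ₃) = (v % k ^ ρ₃) * k ^ (μ₀ + lam) := by
    rw [hKP, Nat.mul_mod_mul_right]
  have hred1 : (v * k ^ (μ₀ + lam) + a * k ^ μ₀) % k ^ (μ₀ + lam + ρ₃) =
      a * k ^ μ₀ + (v % k ^ ρ₃) * k ^ (μ₀ + lam) := by
    -- `a k^{μ₀} + (v mod k^{ρ₃}) k^α < k^{α+ρ₃}`
    have hlt : a * k ^ μ₀ + v % k ^ ρ₃ * k ^ (μ₀ + lam) < k ^ (μ₀ + lam + ρ₃) := by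
      have h1 : v % k ^ ρ₃ + 1 ≤ k ^ ρ₃ := Nat.mod_lt _ (by positivity)
      calc a * k ^ μ₀ + v % k ^ ρ₃ * k ^ (μ₀ + lam) < k ^ (μ₀ + lam) + v % k ^ ρ₃ * k ^ (μ₀ + lam) := by omega
        _ = (v % k ^ ρ₃ + 1) * k ^ (μ₀ + lam) := by ring
        _ ≤ k ^ ρ₃ * k ^ (μ₀ + lam) := Nat.mul_le_mul_right _ h1
        _ = k ^ (μ₀ + lam + ρ₃) := hKP.symm
    have hv' : v * k ^ (μ₀ + lam) + a * k ^ μ₀ =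
        (a * k ^ μ₀ + v % k ^ ρ₃ * k ^ (μ₀ + lam)) + (v / k ^ ρ₃) * k ^ (μ₀ + lam + ρ₃) := by
      rw [hKP]
      conv_lhs => rw [← Nat.mod_add_div v (k ^ ρ₃)]
      ring
    rw [hv', Nat.add_mul_mod_self_right, Nat.mod_eq_of_lt hlt]
  -- matrices
  have key : umat U f (a * k ^ μ₀ + v * k ^ (μ₀ + lam)) * (umat U f (v * k ^ (μ₀ + lam)))ᴴ =
      umat U f (a * k ^ μ₀ + v % k ^ ρ₃ * k ^ (μ₀ + lam)) * (umat U f (v % k ^ ρ₃ * k ^ (μ₀ + lam)))ᴴ := by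
    rw [umat_mul_conjTranspose, umat_mul_conjTranspose, add_comm (a * k ^ μ₀) (v * k ^ (μ₀ + lam)), hq,
      hred1, hred2]
  calc umat U f (a * k ^ μ₀ + v * k ^ (μ₀ + lam))
      = umat U f (a * k ^ μ₀ + v * k ^ (μ₀ + lam)) * (umat U f (v * k ^ (μ₀ + lam)))ᴴ *
          umat U f (v * k ^ (μ₀ + lam)) := by
        rw [Matrix.mul_assoc, conjTranspose_mul_self_unitary, Matrix.mul_one]
    _ = umat U f (a * k ^ μ₀ + v % k ^ ρ₃ * k ^ (μ₀ + lam)) * (umat U f (v % k ^ ρ₃ * k ^ (μ₀ + lam)))ᴴ *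
          umat U f (v * k ^ (μ₀ + lam)) := by rw [key]

/-- The difference of the two unitary-valued sequences is at most `2√d`. [folklore] -/
theorem norm_gmat_sub_gmatMain_le (U : G →* unitaryGroup d ℂ) (f : ℕ → G) (k μ₀ μ₁ μ₂ lam ρ₃ u : ℕ) :
    ‖gmat U f k μ₀ μ₁ μ₂ u - gmatMain U f k μ₀ μ₁ lam ρ₃ u‖ ≤ 2 * Real.sqrt (Fintype.card d) := by
  refine (norm_sub_le _ _).trans ?_
  rw [norm_gmat, norm_gmatMain]
  linarith

/-! ## The `G₂`-part by Parseval -/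

/-- Counting: `#{u < k^{λ+λ'} : ⌊u/k^λ⌋ ∈ V} ≤ k^λ · #V`. [folklore] -/
theorem card_filter_div_mem_le (k lam lam' : ℕ) (V : Finset ℕ) :
    ((range (k ^ (lam + lam'))).filter (fun u => u / k ^ lam ∈ V)).card ≤ k ^ lam * V.card := by
  classical
  rcases Nat.eq_zero_or_pos (k ^ lam) with h0 | hpos
  · -- degenerate: `k^λ = 0` forces `k = 0`, `λ > 0`, and the range is empty
    have : k ^ (lam + lam') = 0 := by
      rw [pow_add, h0, zero_mul]
    simp [this]
  calc ((range (k ^ (lam + lam'))).filter (fun u => u / k ^ lam ∈ V)).card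
      ≤ ((V ×ˢ range (k ^ lam)).image fun p : ℕ × ℕ => p.2 + p.1 * k ^ lam).card := by
        refine card_le_card fun u hu => ?_
        rw [mem_filter, mem_range] at hu
        rw [mem_image]
        refine ⟨(u / k ^ lam, u % k ^ lam), mem_product.2 ⟨hu.2, mem_range.2 (Nat.mod_lt _ hpos)⟩, ?_⟩
        dsimp only
        rw [mul_comm]
        exact Nat.mod_add_div u (k ^ lam)
    _ ≤ (V ×ˢ range (k ^ lam)).card := card_image_le
    _ = k ^ lam * V.card := by rw [card_product, card_range, mul_comm]

/-- **The `G₂`-part of Lemma 11** (MR p. 2627): by Parseval over all `k^Λ` integer shifts,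
`∑_{j<k^Λ} ‖dftR k^Λ (gmat − gmatMain) (j + t)‖² ≤ 4d · k^λ · #V / k^Λ`, `Λ = λ + λ'`,
`V = carryViolations k f λ' (μ₀+λ) ρ₃` (`k ≥ 1`, `μ₀ ≤ μ₁`, `μ₁−μ₀ ≤ λ`).
[cite: MauduitRivat2015, Lemma 11 (proof, the estimate of G_{…,λ,2})] -/
theorem sum_norm_sq_dftR_gmatErr_le (U : G →* unitaryGroup d ℂ) (f : ℕ → G) {k : ℕ} (hk : 0 < k)
    {μ₀ μ₁ μ₂ lam lam' : ℕ} (h01 : μ₀ ≤ μ₁) (hlam : μ₁ - μ₀ ≤ lam) (hsum : μ₀ + lam + lam' = μ₂)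
    (ρ₃ : ℕ) (t : ℝ) :
    ∑ j ∈ range (k ^ (lam + lam')),
        ‖dftR (k ^ (lam + lam')) (fun u => gmat U f k μ₀ μ₁ μ₂ u - gmatMain U f k μ₀ μ₁ lam ρ₃ u) ((j : ℝ) + t)‖ ^ 2 ≤
      4 * Fintype.card d * k ^ lam * (carryViolations k f lam' (μ₀ + lam) ρ₃).card / k ^ (lam + lam') := by
  classical
  have hK : 0 < k ^ (lam + lam') := by positivity
  set V := carryViolations k f lam' (μ₀ + lam) ρ₃ with hV
  rw [sum_norm_sq_dftR hK, inv_mul_eq_div, Nat.cast_pow]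
  gcongr
  -- split the `u`-sum into digits and use that the difference vanishes off `V`
  rw [sum_range_pow_add_digitSplit _ k lam lam']
  have hterm : ∀ v ∈ range (k ^ lam'), ∀ a ∈ range (k ^ lam),
      ‖gmat U f k μ₀ μ₁ μ₂ (a + v * k ^ lam) - gmatMain U f k μ₀ μ₁ lam ρ₃ (a + v * k ^ lam)‖ ^ 2 ≤
        if v ∈ V then (4 * Fintype.card d : ℝ) else 0 := by
    intro v hv a ha
    split_ifs with hmem
    · have h := norm_gmat_sub_gmatMain_le U f k μ₀ μ₁ μ₂ lam ρ₃ (a + v * k ^ lam)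
      have h0 := norm_nonneg (gmat U f k μ₀ μ₁ μ₂ (a + v * k ^ lam) - gmatMain U f k μ₀ μ₁ lam ρ₃ (a + v * k ^ lam))
      calc ‖gmat U f k μ₀ μ₁ μ₂ (a + v * k ^ lam) - gmatMain U f k μ₀ μ₁ lam ρ₃ (a + v * k ^ lam)‖ ^ 2
          ≤ (2 * Real.sqrt (Fintype.card d)) ^ 2 := pow_le_pow_left₀ h0 h 2
        _ = 4 * Fintype.card d := by
            rw [mul_pow, Real.sq_sqrt (Nat.cast_nonneg _)]; ring
    · rw [gmat_eq_gmatMain_of_not_mem U f hk h01 hlam hsum (mem_range.1 ha) (mem_range.1 hv) hmem,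
        sub_self, norm_zero]
      simp
  calc ∑ v ∈ range (k ^ lam'), ∑ a ∈ range (k ^ lam),
        ‖gmat U f k μ₀ μ₁ μ₂ (a + v * k ^ lam) - gmatMain U f k μ₀ μ₁ lam ρ₃ (a + v * k ^ lam)‖ ^ 2
      ≤ ∑ v ∈ range (k ^ lam'), ∑ _a ∈ range (k ^ lam), (if v ∈ V then (4 * Fintype.card d : ℝ) else 0) :=
        sum_le_sum fun v hv => sum_le_sum fun a ha => hterm v hv a ha
    _ = k ^ lam * ∑ v ∈ range (k ^ lam'), (if v ∈ V then (4 * Fintype.card d : ℝ) else 0) := by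
        rw [mul_sum]
        refine sum_congr rfl fun v _ => ?_
        rw [sum_const, card_range, nsmul_eq_mul, Nat.cast_pow]
    _ ≤ k ^ lam * (4 * Fintype.card d * V.card) := by
        gcongr
        rw [← sum_filter, sum_const, nsmul_eq_mul]
        calc ((((range (k ^ lam')).filter (fun v => v ∈ V)).card : ℕ) : ℝ) * (4 * Fintype.card d)
            ≤ (V.card : ℝ) * (4 * Fintype.card d) := by
              gcongr
              exact fun v hv => (mem_filter.1 hv).2
          _ = 4 * Fintype.card d * V.card := by ring
    _ = 4 * Fintype.card d * k ^ lam * V.card := by ring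

/-- **The `G₂`-part under the carry property**: if `HasCarryProperty k η C f` and `ρ₃ < λ'` then
`∑_{j<k^Λ} ‖dftR k^Λ (gmat − gmatMain) (j + t)‖² ≤ 4dC · k^{−ηρ₃}` (`k ≥ 1`).
[cite: MauduitRivat2015, Lemma 11 (proof, "≤ q^{−ρ₃}")] [cite: Mullner2017, Lemma 5.6] -/
theorem sum_norm_sq_dftR_gmatErr_le_of_carry (U : G →* unitaryGroup d ℂ) {f : ℕ → G} {k : ℕ} (hk : 0 < k)
    {η C : ℝ} (hf : HasCarryProperty k η C f)
    {μ₀ μ₁ μ₂ lam lam' ρ₃ : ℕ} (h01 : μ₀ ≤ μ₁) (hlam : μ₁ - μ₀ ≤ lam) (hsum : μ₀ + lam + lam' = μ₂)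
    (hρ : ρ₃ < lam') (t : ℝ) :
    ∑ j ∈ range (k ^ (lam + lam')),
        ‖dftR (k ^ (lam + lam')) (fun u => gmat U f k μ₀ μ₁ μ₂ u - gmatMain U f k μ₀ μ₁ lam ρ₃ u) ((j : ℝ) + t)‖ ^ 2 ≤
      4 * Fintype.card d * C * (k : ℝ) ^ (-(η * ρ₃)) := by
  have hkR : (0 : ℝ) < k := by exact_mod_cast hk
  refine (sum_norm_sq_dftR_gmatErr_le U f hk h01 hlam hsum ρ₃ t).trans ?_
  have hV := hf lam' (μ₀ + lam) ρ₃ hρ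
  rw [div_le_iff₀ (by positivity)]
  calc 4 * (Fintype.card d : ℝ) * k ^ lam * ((carryViolations k f lam' (μ₀ + lam) ρ₃).card : ℝ)
      ≤ 4 * Fintype.card d * k ^ lam * (C * (k : ℝ) ^ ((lam' : ℝ) - η * ρ₃)) := by gcongr
    _ = 4 * Fintype.card d * C * (k : ℝ) ^ (-(η * ρ₃)) * k ^ (lam + lam') := by
        rw [show ((lam' : ℝ) - η * ρ₃) = -(η * ρ₃) + lam' by ring, Real.rpow_add hkR,
          Real.rpow_natCast, pow_add]
        ring

end Literature.NumberTheory.LFunctions.MauduitRivat
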